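import Summits.QuantumFields.BalabanUV.Beta.CombChartContactFactor

/-!
# `BalabanUV.Beta.CombChartShiftNull` — binder row D1, RULING R-D1-g35-1 (chart (III′)), brick P6-0: **THE TWO SHIFT NULLITIES (GD) OF an1's LEGS AGAINST THE
# COMB-CHART RESOLVENT** — `(G′_j ∘ Dsh Lc)_mf = 0` and `(Dsh Lc ∘ G′_j)_fm = 0` for `G′_j = GcombSh Lc j`, every level

HONEST FRAMING (cell contract, verbatim): «discharging `BetaPertH` makes Bałaban's UV stability UNCONDITIONAL — a real constructive-QFT
result; it is NOT the continuum limit and NOT the Clay problem.»  HONEST DEPENDENCY: continuum YM on T⁴ ⇐ BetaPertH ∧ nine spine estimates (0/9 proved);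
BetaPertH ⇐ (D1) ∧ (D4) ∧ CAP+tail; G-an2-4 gates asym, D1 and NE2/3/4.
DERIVED cell leaf ([folklore] kernel bookkeeping BY NAME; β sub-cell, BINDER-OWNERS row D1 OWNER `b2b-balaban-beta-an2` gen 36).  No statement of Bałaban's papers,
no `[cite:]`, no `Prop` fact, no `def`.  Discharges NO binder by itself; RECORD = ROOT M′ p303989 (chart (II)) unchanged; NOT D1, NOT `BetaPertH`, NOT continuum, NOT Clay.
WHY.  The chart-(II) second-order hR engines (`SecondOrderStepEvalSym`, `SpineRecursiveT2StepSym` → `…WLawSym` → `…T2AllSym` → `…WEndSym(Tables)`) display the two shift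
nullities (DG) `hGD : (G_j ∘ Dsh)_mf = 0`, `hDG : (Dsh ∘ G_j)_fm = 0` and discharge them at `Gsym` by `SymShiftGaugeBlind` ∕ `SymResolventPseudoInverse`.  Both involve
ONLY the multiplier–multiplier block of the resolvent (`Dsh_ff = 0`), which the rooted comb dressing does not touch (`CombChartContactFactor.GcombSh_inr_inr`); so they
transfer verbatim to `G′_j` — the input the successor's (III′) engine twins (owner programme P6) consume.  §1 `comp_GcombSh_Dsh_inr_inl`, `comp_Dsh_GcombSh_inl_inr`.
Provenance: β sub-cell, unit beta-an2 gen 36, 2026-08-22 (v1); over `CombChartContactFactor` (this gen; `comp_Gsym_Dsh_inr_inl`, `GcombSh_inr_inr`) and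
`SymResolventPseudoInverse.comp_Dsh_Gsym_inl_inr` BY NAME; no existing file touched.
-/

noncomputable section

open Finset
open scoped BigOperators
open Literature.MathematicalPhysics.QuantumFieldTheory
open Literature.MathematicalPhysics.QuantumFieldTheory.Balaban1983to89
open Literature.MathematicalPhysics.QuantumFieldTheory.Balaban1983to89.Beta
open ExpKernelCalculus (MKer comp)
open OneStepResolventKernel (Fib)
open Summit.QuantumFields.BalabanUV.Beta.TameKernelCalculus
open Summit.QuantumFields.BalabanUV.Beta.SymmetrisedStepJets (Gsym)
open Summit.QuantumFields.BalabanUV.Beta.DshAn1 (Dsh Dsh_inl_inl)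
open Summit.QuantumFields.BalabanUV.Beta.SymResolventPseudoInverse (comp_Dsh_Gsym_inl_inr)
open Summit.QuantumFields.BalabanUV.Beta.CombChartStepJets (GcombSh)
open Summit.QuantumFields.BalabanUV.Beta.CombChartContactFactor (comp_Gsym_Dsh_inr_inl GcombSh_inr_inr)

namespace Summit.QuantumFields.BalabanUV.Beta.CombChartShiftNull

variable {d Lc : ℕ} [NeZero Lc]

/-- [folklore] **(GD) FOR THE COMB-CHART RESOLVENT, ROW FORM**: `(GcombSh Lc j ∘ Dsh Lc)_mf = 0` — the summand equals that of `(Gsym Lc j ∘ Dsh Lc)_mf` term by term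
(`Dsh_ff = 0`, `G′_mm = G_mm`), and the latter vanishes (`CombChartContactFactor.comp_Gsym_Dsh_inr_inl`). -/
theorem comp_GcombSh_Dsh_inr_inl (j : ℕ) (x z : Fin (d + 1) → ℤ) (m b : Fin (d + 1)) :
    comp (GcombSh (d := d) Lc j) (Dsh Lc) x z (Sum.inr m) (Sum.inl b) = 0 := by
  rw [← comp_Gsym_Dsh_inr_inl (d := d) (Lc := Lc) j x z m b]
  unfold ExpKernelCalculus.comp
  refine tsum_congr fun y => ?_
  rw [Fintype.sum_sum_type, Fintype.sum_sum_type]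
  simp only [Dsh_inl_inl, mul_zero, Finset.sum_const_zero, zero_add]
  exact Finset.sum_congr rfl fun m' _ => by rw [GcombSh_inr_inr j]

/-- [folklore] **(GD) FOR THE COMB-CHART RESOLVENT, COLUMN FORM**: `(Dsh Lc ∘ GcombSh Lc j)_fm = 0` (`SymResolventPseudoInverse.comp_Dsh_Gsym_inl_inr` the same way). -/
theorem comp_Dsh_GcombSh_inl_inr (j : ℕ) (x z : Fin (d + 1) → ℤ) (a m : Fin (d + 1)) :
    comp (Dsh Lc) (GcombSh (d := d) Lc j) x z (Sum.inl a) (Sum.inr m) = 0 := by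
  rw [← comp_Dsh_Gsym_inl_inr (d := d) (Lc := Lc) j x z a m]
  unfold ExpKernelCalculus.comp
  refine tsum_congr fun y => ?_
  rw [Fintype.sum_sum_type, Fintype.sum_sum_type]
  simp only [Dsh_inl_inl, zero_mul, Finset.sum_const_zero, zero_add]
  exact Finset.sum_congr rfl fun m' _ => by rw [GcombSh_inr_inr j]

/-- [folklore] Both nullities, every level, packaged as the pair the engines display. -/
theorem shiftNull_GcombSh :
    (∀ (j : ℕ) (x z : Fin (d + 1) → ℤ) (m a : Fin (d + 1)), comp (GcombSh (d := d) Lc j) (Dsh Lc) x z (Sum.inr m) (Sum.inl a) = 0) ∧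
      (∀ (j : ℕ) (x z : Fin (d + 1) → ℤ) (a m : Fin (d + 1)), comp (Dsh Lc) (GcombSh (d := d) Lc j) x z (Sum.inl a) (Sum.inr m) = 0) :=
  ⟨fun j x z m a => comp_GcombSh_Dsh_inr_inl j x z m a, fun j x z a m => comp_Dsh_GcombSh_inl_inr j x z a m⟩

end Summit.QuantumFields.BalabanUV.Beta.CombChartShiftNull

end
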